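import Summits.ValiantsHypothesis.ValiantsHypothesis.Theorems.GrenetZeonDualUnipotentThreeHalvesLongMassRankOne

/-!
# `GrenetZeon.DualUnipotentThreeHalves` (stmt-ValiantsHypothesis-24318), line `slow_core`, stub `stub_longMassSlowLawInv` ((c)):
# HEREDITARILY NILPOTENT MATRICES ARE ACYCLIC (combinatorial core of the rank-one-generated row)

Pure matrix combinatorics (any index type `ι`, entries in `ℂ`).  Call `G : Matrix ι ι ℂ` HEREDITARILY NILPOTENT if every principal
submatrix `G.submatrix c c` (`c : Fin k → ι` injective) is nilpotent.  THEOREM ★ `exists_levels_of_hereditarilyNilpotent`: then the digraph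
`e → e' :⇔ G e e' ≠ 0` is ACYCLIC, i.e. carries a level function `ℓ : ι → ℕ` with `G e e' ≠ 0 → ℓ e < ℓ e'` (so `G` is strictly upper
triangular after a permutation).

Proof.  A closed walk of length `L = d+1` is `w : Fin (d+1) → ι` with `G (w a) (w (a+1)) ≠ 0` for all `a` (cyclic `+1` of `Fin (d+1)`).
§1 RE-ROOTING `exists_shorter_closedWalk`: a CHORD `G (w a) (w b) ≠ 0` with `b ≠ a + 1` yields the strictly shorter closed walk
`b, b+1, …, a, b`.  §2 `not_closedWalk`: a closed walk of MINIMAL length has no chords; hence it is injective and its principal submatrix is a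
weighted cyclic shift `diagonal h · P_{finRotate}`, whose determinant `± Π h` is non-zero — contradicting nilpotency.  So a hereditarily nilpotent
matrix has NO closed walk.  §3 `transGen walks`: the transitive closure of `→` is then irreflexive, and `ℓ e := #{e'' : e'' →⁺ e}` is a level
function (`Finset.card_lt_card`).

USE (sequel `…LongMassRankOneTriangular`, same seat): for a LINEAR pencil all of whose coefficient matrices are outer products `u_e w_eᵀ`, nilpotency
makes the Gram matrix `G e e' := w_e · u_{e'}` hereditarily nilpotent, the levels give a strictly decreasing invariant flag, McCoy's criterion
(✓ Literature `forall_isNilpotent_iff_exists_isUnit`) triangularises the pencil, and ✓ `TriangularRow.relCert_of_values_triangularisable` prices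
it at `3·√n·b` — (c) HOLDS on the rank-one-generated linear locus.  Honest framing: support lemma (`--supports stmt-ValiantsHypothesis-24318`); (c)
`SlowCore.LongMassSlowLawInv`, S3, 24318, 8062, VP ≠ VNP OPEN / NOT proved.  No sorry, no definitions, no named facts. [folklore]
-/

-- single-conjunct layout: Sub = Summit, duplicated namespace component intended (the name is mandated)
set_option linter.dupNamespace false
set_option autoImplicit false

noncomputable section

namespace Summit.ValiantsHypothesis.ValiantsHypothesis.Theorems.GrenetZeon.LongMassRankOne

open Matrix
open scoped BigOperators

variable {ι : Type*}

/-! ## §1 Re-rooting a closed walk at a chord -/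

/-- `Fin.castLE` commutes with `+1` below the top. -/
theorem castLE_add_one {d n : ℕ} (h : d + 1 ≤ n + 1) (i : Fin (d + 1)) (hi : i ≠ Fin.last d) :
    (Fin.castLE h (i + 1) : Fin (n + 1)) = Fin.castLE h i + 1 := by
  apply Fin.ext
  have h1 : ((i + 1 : Fin (d + 1)) : ℕ) = (i : ℕ) + 1 := by rw [Fin.val_add_one, if_neg hi]
  have hne : (Fin.castLE h i : Fin (n + 1)) ≠ Fin.last n := by
    intro heq
    have := congrArg Fin.val heq
    rw [Fin.val_castLE, Fin.val_last] at this
    have hi' : (i : ℕ) < d := Fin.val_lt_last hi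
    omega
  have h2 : ((Fin.castLE h i + 1 : Fin (n + 1)) : ℕ) = (i : ℕ) + 1 := by rw [Fin.val_add_one, if_neg hne, Fin.val_castLE]
  rw [Fin.val_castLE, h1, h2]

/-- **RE-ROOTING.**  A closed walk `w : Fin (n+1) → ι` (edges `w a → w (a+1)`, all of non-zero weight) with a CHORD `G (w a) (w b) ≠ 0`,
`b ≠ a + 1`, contains the strictly shorter closed walk `b, b+1, …, a, b` of length `(a − b) + 1 ≤ n`. -/
theorem exists_shorter_closedWalk (G : Matrix ι ι ℂ) {n : ℕ} (w : Fin (n + 1) → ι) (hw : ∀ a, G (w a) (w (a + 1)) ≠ 0)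
    (a b : Fin (n + 1)) (hab : G (w a) (w b) ≠ 0) (hb : b ≠ a + 1) :
    ∃ d : ℕ, d < n ∧ ∃ w' : Fin (d + 1) → ι, ∀ i, G (w' i) (w' (i + 1)) ≠ 0 := by
  set δ : Fin (n + 1) := a - b with hδ
  have hbδ : b + δ = a := by rw [hδ]; exact add_sub_cancel b a
  have hδn : (δ : ℕ) < n := by
    rcases (Nat.lt_or_ge (δ : ℕ) n) with h | h
    · exact h
    · exfalso
      have hδlast : δ = Fin.last n := Fin.ext (by rw [Fin.val_last]; have := δ.is_lt; omega)
      apply hb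
      rw [← hbδ, hδlast, add_assoc, Fin.last_add_one, add_zero]
  have hle : (δ : ℕ) + 1 ≤ n + 1 := by omega
  refine ⟨δ, hδn, fun i => w (b + Fin.castLE hle i), fun i => ?_⟩
  dsimp only
  by_cases hi : i = Fin.last δ
  · -- the closing chord `a → b`
    have hlast : (Fin.castLE hle (Fin.last (δ : ℕ)) : Fin (n + 1)) = δ := Fin.ext (by rw [Fin.val_castLE, Fin.val_last])
    rw [hi, Fin.last_add_one, hlast, hbδ]
    simpa using hab
  · -- an edge of the old walk
    rw [castLE_add_one hle i hi, ← add_assoc]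
    exact hw _

/-! ## §2 Hereditarily nilpotent matrices have no closed walk -/

/-- A closed walk WITHOUT CHORDS (`G (w a) (w b) ≠ 0 → b = a + 1`) is injective. -/
theorem injective_of_noChord (G : Matrix ι ι ℂ) {n : ℕ} (w : Fin (n + 1) → ι) (hw : ∀ a, G (w a) (w (a + 1)) ≠ 0)
    (hnc : ∀ a b, G (w a) (w b) ≠ 0 → b = a + 1) : Function.Injective w := by
  intro a b hab
  have h := hw a
  rw [hab] at h
  have := hnc b (a + 1) h
  exact add_right_cancel this

/-- The principal submatrix of a chordless closed walk is the weighted cyclic shift `diagonal h · P_{+1}`. -/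
theorem submatrix_eq_of_noChord (G : Matrix ι ι ℂ) {n : ℕ} (w : Fin (n + 1) → ι)
    (hnc : ∀ a b, G (w a) (w b) ≠ 0 → b = a + 1) :
    G.submatrix w w = Matrix.diagonal (fun a => G (w a) (w (a + 1))) *
      (1 : Matrix (Fin (n + 1)) (Fin (n + 1)) ℂ).submatrix (finRotate (n + 1)) id := by
  ext a b
  rw [Matrix.submatrix_apply, Matrix.diagonal_mul, Matrix.submatrix_apply, id, finRotate_apply, Matrix.one_apply]
  by_cases h : a + 1 = b
  · rw [if_pos h, mul_one, h]
  · rw [if_neg h, mul_zero]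
    by_contra hne
    exact h (hnc a b hne).symm

/-- The weighted cyclic shift with non-zero weights has non-zero determinant. -/
theorem det_submatrix_ne_zero_of_noChord (G : Matrix ι ι ℂ) {n : ℕ} (w : Fin (n + 1) → ι) (hw : ∀ a, G (w a) (w (a + 1)) ≠ 0)
    (hnc : ∀ a b, G (w a) (w b) ≠ 0 → b = a + 1) : (G.submatrix w w).det ≠ 0 := by
  rw [submatrix_eq_of_noChord G w hnc, Matrix.det_mul, Matrix.det_diagonal, Matrix.det_permute, Matrix.det_one, mul_one]
  refine mul_ne_zero (Finset.prod_ne_zero_iff.mpr fun a _ => hw a) ?_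
  exact Int.cast_ne_zero.mpr (Units.ne_zero _)

/-- ★ **A HEREDITARILY NILPOTENT MATRIX HAS NO CLOSED WALK** (of non-zero weights). -/
theorem not_closedWalk_of_hereditarilyNilpotent (G : Matrix ι ι ℂ)
    (hG : ∀ (k : ℕ) (c : Fin k → ι), Function.Injective c → IsNilpotent (G.submatrix c c)) :
    ∀ (n : ℕ) (w : Fin (n + 1) → ι), ¬ ∀ a, G (w a) (w (a + 1)) ≠ 0 := by
  -- minimal counterexample
  by_contra hex
  push Not at hex
  have hP : ∃ n : ℕ, ∃ w : Fin (n + 1) → ι, ∀ a, G (w a) (w (a + 1)) ≠ 0 := hex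
  classical
  set n := Nat.find hP with hn
  obtain ⟨w, hw⟩ : ∃ w : Fin (n + 1) → ι, ∀ a, G (w a) (w (a + 1)) ≠ 0 := Nat.find_spec hP
  -- no chords, by minimality and re-rooting
  have hnc : ∀ a b, G (w a) (w b) ≠ 0 → b = a + 1 := by
    intro a b hab
    by_contra hb
    obtain ⟨d, hd, w', hw'⟩ := exists_shorter_closedWalk G w hw a b hab hb
    exact Nat.find_min hP (by rw [← hn]; exact hd) ⟨w', hw'⟩
  -- the principal submatrix is nilpotent with non-zero determinant
  obtain ⟨N, hN⟩ := hG (n + 1) w (injective_of_noChord G w hw hnc)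
  have hdet := congrArg Matrix.det hN
  rw [Matrix.det_pow, Matrix.det_zero] at hdet
  exact det_submatrix_ne_zero_of_noChord G w hw hnc (pow_eq_zero_iff'.mp hdet).1

/-! ## §3 Walks of the transitive closure; the level function -/

/-- An element of the transitive closure of `e → e' :⇔ G e e' ≠ 0` is witnessed by an open walk. -/
theorem exists_walk_of_transGen (G : Matrix ι ι ℂ) {e e' : ι} (h : Relation.TransGen (fun x y => G x y ≠ 0) e e') :
    ∃ (n : ℕ) (w : Fin (n + 2) → ι), w 0 = e ∧ w (Fin.last (n + 1)) = e' ∧ ∀ i : Fin (n + 1), G (w i.castSucc) (w i.succ) ≠ 0 := by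
  induction h with
  | single hxy =>
    refine ⟨0, ![e, _], rfl, rfl, fun i => ?_⟩
    have hi : i = 0 := Fin.eq_zero i
    subst hi
    exact hxy
  | @tail y z _ hyz ih =>
    obtain ⟨n, w, h0, hlast, hw⟩ := ih
    refine ⟨n + 1, Fin.snoc w z, ?_, ?_, fun i => ?_⟩
    · rw [show (0 : Fin (n + 1 + 2)) = (0 : Fin (n + 2)).castSucc from rfl, Fin.snoc_castSucc, h0]
    · rw [show Fin.last (n + 1 + 1) = Fin.last (n + 2) from rfl, Fin.snoc_last]
    · by_cases hi : i = Fin.last (n + 1)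
      · subst hi
        rw [Fin.succ_last, Fin.snoc_last, Fin.snoc_castSucc, hlast]
        exact hyz
      · -- an old edge
        set j : Fin (n + 1) := i.castPred hi with hj
        have hij : i = j.castSucc := by rw [hj, Fin.castSucc_castPred]
        rw [hij, Fin.snoc_castSucc, Fin.succ_castSucc, Fin.snoc_castSucc]
        exact hw j

/-- ★ **The transitive closure of `→` is IRREFLEXIVE for a hereditarily nilpotent matrix** (an open walk from `e` to `e` closes up). -/
theorem transGen_irrefl_of_hereditarilyNilpotent (G : Matrix ι ι ℂ)
    (hG : ∀ (k : ℕ) (c : Fin k → ι), Function.Injective c → IsNilpotent (G.submatrix c c)) (e : ι) :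
    ¬ Relation.TransGen (fun x y => G x y ≠ 0) e e := by
  intro h
  obtain ⟨n, w, h0, hlast, hw⟩ := exists_walk_of_transGen G h
  refine not_closedWalk_of_hereditarilyNilpotent G hG n (fun i => w i.castSucc) fun a => ?_
  by_cases ha : a = Fin.last n
  · subst ha
    rw [Fin.last_add_one, Fin.castSucc_zero, h0, ← hlast, ← Fin.succ_last]
    exact hw _
  · have h1 : (a + 1 : Fin (n + 1)).castSucc = a.succ := by
      apply Fin.ext
      rw [Fin.val_castSucc, Fin.val_succ, Fin.val_add_one, if_neg ha]
    rw [h1]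
    exact hw a

/-- ★ **HEREDITARILY NILPOTENT ⇒ ACYCLIC WITH LEVELS.**  If every principal submatrix of `G` is nilpotent, the digraph `e → e' :⇔ G e e' ≠ 0`
carries a level function: `G e e' ≠ 0 → ℓ e < ℓ e'` (`ℓ e` = the number of `→⁺`-predecessors of `e`).  Equivalently `G` is strictly upper
triangular after a permutation of `ι`. [folklore] -/
theorem exists_levels_of_hereditarilyNilpotent [Fintype ι] (G : Matrix ι ι ℂ)
    (hG : ∀ (k : ℕ) (c : Fin k → ι), Function.Injective c → IsNilpotent (G.submatrix c c)) :
    ∃ ℓ : ι → ℕ, ∀ e e', G e e' ≠ 0 → ℓ e < ℓ e' := by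
  classical
  refine ⟨fun e => (Finset.univ.filter fun x => Relation.TransGen (fun x y => G x y ≠ 0) x e).card, fun e e' hee' => ?_⟩
  apply Finset.card_lt_card
  rw [Finset.ssubset_iff_of_subset]
  · refine ⟨e, ?_, ?_⟩
    · rw [Finset.mem_filter]; exact ⟨Finset.mem_univ _, Relation.TransGen.single hee'⟩
    · rw [Finset.mem_filter, not_and]; exact fun _ => transGen_irrefl_of_hereditarilyNilpotent G hG e
  · intro x hx
    rw [Finset.mem_filter] at hx ⊢
    exact ⟨hx.1, hx.2.tail hee'⟩

end Summit.ValiantsHypothesis.ValiantsHypothesis.Theorems.GrenetZeon.LongMassRankOne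

end
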